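import Summits.Ventures.WeilGRH.DualTrigKernelLatticeSoundA
import Summits.Ventures.WeilGRH.DualTrigKernelLatticeSoundB
import Summits.Ventures.WeilGRH.DualTrigKernelLatticeCells
import HarnessLib

/-!
# Format D-K v3 (multi-lattice): soundness, part C — unpacking the Boolean checks, the covered range,
the atoms in `τ`, assembly lemmas

Cell `rh-explicit`, WEIL TRACK — GRH ARM, route B (weil-grh-3).  From the parts of `DKCert3.checkL`:
what `latsOK`, `latCoverOK`, `cellsOKL` say (`*_sound`); on a checked cell the full function is `≥ 0`,
the base periodic part `≥ mT/S` on base duty and each lattice part `≥ mT_p/S` on its duty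
(`cell_bounds3`), hence on the covered range (`P3_nonneg_of_covered`, `baseT_ge_of_covered`,
`latT_ge_of_covered`); the lattice atoms evaluate to their `trigSum` in `τ` and all atoms have
frequencies `≥ log (N+1)` (`allAtomsT_admissible`); assembly lemmas `frame3OK_of_parts`,
`baseFrameOK_of_parts`, `checkL_of_parts`, `blockRangeOKL_split`, `cellsOKL_of_blocks` for kernel-sized
instance declarations.  Everything here is PROVED; no named facts, no `sorry`, no kernel evaluation.
-/

noncomputable section

open Finset Real Complex

namespace Summit.Ventures.WeilGRH

open Literature.Analysis.ValidatedNumerics.NumericsMP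
open Literature.NumberTheory.LFunctions
open DualTrigTaylor DigammaVertical

namespace DKCert3

variable {c : DKCert3}

/-! ### Unpacking the Boolean checks -/

/-- Unpacking `latsOK`. [folklore] -/
theorem latsOK_sound (h : c.latsOK = true) (hS : 0 < c.base.S)
    (hlog : MI.mem c.base.S (Real.log c.base.p0) c.base.logp0I) :
    (c.lats.map (·.p)).Nodup ∧ c.restTerms.isSome = true ∧ ∀ l ∈ c.lats,
      2 ≤ l.p ∧ l.p ≠ c.base.p0 ∧ 1 ≤ l.D ∧ 0 < l.rI.lo ∧ MI.mem c.base.S (c.ratR l) l.rI ∧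
      (∀ atm ∈ l.atoms, (c.base.N + 1) ^ l.D ≤ l.p ^ atm.k) ∧
      (c.base.even = true → ∀ atm ∈ l.atoms, atm.b = 0) ∧ (c.latWinTerms l).isSome = true := by
  unfold latsOK at h
  simp only [Bool.and_eq_true, decide_eq_true_eq, List.all_eq_true] at h
  obtain ⟨⟨hnd, hrest⟩, hall⟩ := h
  refine ⟨hnd, hrest, fun l hl ↦ ?_⟩
  obtain ⟨⟨⟨⟨⟨⟨⟨hp, hne⟩, hD⟩, hlo⟩, hrat⟩, hadm⟩, heven⟩, hwin⟩ := hall l hl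
  refine ⟨hp, hne, hD, hlo, ?_, fun atm hatm ↦ hadm atm hatm, fun he atm hatm ↦ ?_, hwin⟩
  · cases hL : MI.logNat c.base.S c.base.Kser l.p with
    | none => simp [hL] at hrat
    | some Lp =>
      simp only [hL] at hrat
      cases hR : MI.divPos c.base.S (Lp.mulInt c.base.D) (c.base.logp0I.mulInt l.D) with
      | none => simp [hR] at hrat
      | some R =>
        simp only [hR] at hrat
        have hm := MI.mem_divPos hS hR (MI.mem_mulInt (MI.mem_logNat hS hL) c.base.D) (MI.mem_mulInt hlog l.D)
        refine DKCert.mem_of_encl hrat ?_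
        have e : c.ratR l = Real.log l.p * (c.base.D : ℤ) / (Real.log c.base.p0 * (l.D : ℤ)) := by
          unfold ratR; push_cast; ring
        rw [e]; exact hm
  · simp only [he, Bool.not_true, Bool.false_or, List.all_eq_true, beq_iff_eq] at heven
    exact heven atm hatm

/-- Unpacking `latCoverOK`. [folklore] -/
theorem latCoverOK_sound (h : c.latCoverOK = true) :
    ∃ b0 bl, c.base.blocks.head? = some b0 ∧ c.base.blocks.getLast? = some bl ∧ ∀ l ∈ c.lats,
      (bl.Mc : ℤ) * c.base.S ≤ 2 * (bl.j0 + bl.n) * l.rI.lo ∧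
      (c.base.even = true ∨ 2 * b0.j0 * l.rI.lo ≤ -((b0.Mc : ℤ) * c.base.S)) := by
  unfold latCoverOK at h
  cases hh : c.base.blocks.head? with
  | none => simp [hh] at h
  | some b0 =>
    cases hl : c.base.blocks.getLast? with
    | none => simp [hh, hl] at h
    | some bl =>
      simp only [hh, hl, List.all_eq_true, Bool.and_eq_true, Bool.or_eq_true, decide_eq_true_eq] at h
      exact ⟨b0, bl, rfl, rfl, fun l hl' ↦ h l hl'⟩

/-- Unpacking `latCellsOKL` on one cell. [folklore] -/
theorem latCellsOKL_sound {b : DKBlock} {j : ℤ} : ∀ (ls : List DKLat),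
    c.latCellsOKL b ls (ls.map fun l ↦ (c.latTerms l, c.base.remBlock (c.base.etaPow b) (c.latTerms l))) j = true →
    ∀ l ∈ ls, c.latDuty l b j = true →
      ∃ lo, c.cellLoT3 b (c.latTerms l) (c.base.remBlock (c.base.etaPow b) (c.latTerms l)) j = some lo ∧ l.mT ≤ lo
  | [], _ => by simp
  | l :: ls, h => by
      rw [List.map_cons] at h
      simp only [latCellsOKL, Bool.and_eq_true] at h
      obtain ⟨h1, h2⟩ := h
      intro l' hl' hduty
      rcases List.mem_cons.1 hl' with rfl | hl'
      · unfold latCellOKL at h1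
        rw [hduty] at h1
        simp only [Bool.not_true, Bool.false_or] at h1
        cases hlo : c.cellLoT3 b (c.latTerms l') (c.base.remBlock (c.base.etaPow b) (c.latTerms l')) j with
        | none => simp [hlo] at h1
        | some lo => simp only [hlo, decide_eq_true_eq] at h1; exact ⟨lo, rfl, h1⟩
      · exact latCellsOKL_sound ls h2 l' hl' hduty

/-- Unpacking `cellsOKL`: every cell of every block passed the full check and the lattice duties.
[folklore] -/
theorem cellsOKL_sound (h : c.cellsOKL = true) {b : DKBlock} (hb : b ∈ c.base.blocks) {i : ℕ} (hi : i < b.n) :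
    (∃ lo loT : ℤ, c.cellLo3 b c.terms3 (c.base.remBlock (c.base.etaPow b) c.terms3) (b.j0 + i) = some (lo, loT) ∧
      0 ≤ lo ∧ (DKCert.periodDuty b (b.j0 + i) = true → c.base.mT ≤ loT)) ∧
    ∀ l ∈ c.lats, c.latDuty l b (b.j0 + i) = true →
      ∃ lo, c.cellLoT3 b (c.latTerms l) (c.base.remBlock (c.base.etaPow b) (c.latTerms l)) (b.j0 + i) = some lo ∧
        l.mT ≤ lo := by
  unfold cellsOKL at h
  rw [List.all_eq_true] at h
  have hb' := h b hb
  unfold blockRangeOKL at hb'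
  simp only [List.all_eq_true, List.mem_range, Bool.and_eq_true] at hb'
  obtain ⟨hc, hl⟩ := hb' i hi
  simp only [zero_add] at hc hl
  refine ⟨?_, latCellsOKL_sound c.lats (by unfold latData at hl; exact hl)⟩
  unfold cellOK3 at hc
  cases hcl : c.cellLo3 b c.terms3 (c.base.remBlock (c.base.etaPow b) c.terms3) (b.j0 + i) with
  | none => simp [hcl] at hc
  | some p =>
    obtain ⟨lo, loT⟩ := p
    simp only [hcl, Bool.and_eq_true, decide_eq_true_eq, Bool.or_eq_true, Bool.not_eq_true'] at hc
    refine ⟨lo, loT, rfl, hc.1, fun hd ↦ ?_⟩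
    rcases hc.2 with h' | h'
    · rw [hd] at h'; exact absurd h' (by decide)
    · exact h'

/-- The three cell bounds on every cell of every block (the conclusion of `cell_bounds3`; the interface through which a cell
checker — `cellsOKL` here, `cellsOKP` in `DualTrigKernelLatticeFast` — feeds the covered-range theorems). [folklore] -/
def CellBounds (c : DKCert3) : Prop :=
  ∀ ⦃b : DKBlock⦄, b ∈ c.base.blocks → ∀ ⦃i : ℕ⦄, i < b.n → ∀ ⦃θ : ℝ⦄,
    2 * π * ((b.j0 + i : ℤ) : ℝ) / b.Mc ≤ θ → θ ≤ 2 * π * (((b.j0 + i : ℤ) : ℝ) + 1) / b.Mc →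
    0 ≤ c.P3 θ ∧
      (DKCert.periodDuty b (b.j0 + i) = true → (c.base.mT : ℝ) / c.base.S ≤ sumVal (DKCert.cList c.terms3 c.terms3R) θ) ∧
      ∀ l ∈ c.lats, c.latDuty l b (b.j0 + i) = true → (l.mT : ℝ) / c.base.S ≤ sumVal (c.latTermsR l) θ

/-! ### The three regimes -/

section regimes

variable (hS : 0 < c.base.S) (hpi : MI.mem c.base.S Real.pi c.base.piI) (hrho : MI.mem c.base.S c.base.rhoR c.base.rhoI)
  (hρ : 0 < c.base.rhoR) (hC : MI.mem c.base.S c.base.constR c.base.constI) (hR : 1 ≤ c.base.R)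
  (hF : List.Forall₂ (DKCert.GRepr c.base.S c.base.R) c.terms3 c.terms3R)
  (hFl : ∀ l ∈ c.lats, List.Forall₂ (DKCert.GRepr c.base.S c.base.R) (c.latTerms l) (c.latTermsR l))
  (hblocks : c.base.blocksOK = true) (hcells : c.cellsOKL = true)
include hS hpi hrho hρ hC hR hF hFl hblocks hcells

/-- On a checked cell: the full function is `≥ 0`, the base periodic part `≥ mT/S` on base duty, and every
lattice part `≥ mT_p/S` on its duty. [folklore] -/
theorem cell_bounds3 {b : DKBlock} (hb : b ∈ c.base.blocks) {i : ℕ} (hi : i < b.n) {θ : ℝ}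
    (h1 : 2 * π * ((b.j0 + i : ℤ) : ℝ) / b.Mc ≤ θ) (h2 : θ ≤ 2 * π * (((b.j0 + i : ℤ) : ℝ) + 1) / b.Mc) :
    0 ≤ c.P3 θ ∧
      (DKCert.periodDuty b (b.j0 + i) = true → (c.base.mT : ℝ) / c.base.S ≤ sumVal (DKCert.cList c.terms3 c.terms3R) θ) ∧
      ∀ l ∈ c.lats, c.latDuty l b (b.j0 + i) = true → (l.mT : ℝ) / c.base.S ≤ sumVal (c.latTermsR l) θ := by
  obtain ⟨hbs, _, _⟩ := DKCert.blocksOK_sound hblocks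
  obtain ⟨hMc, hn, hnin, hden, heta, htab⟩ := hbs b hb
  obtain ⟨heta', hnum⟩ := DKCert.eta_ge hS hpi hMc hden heta
  obtain ⟨⟨lo, loT, hcl, hlo, hduty⟩, hlat⟩ := cellsOKL_sound hcells hb hi
  have hSr : (0 : ℝ) < c.base.S := by exact_mod_cast hS
  obtain ⟨hP, hT⟩ := cellLo3_sound hS hpi hρ hrho hC hR hMc hden hnin hnum heta' htab hF (b.j0 + i) hcl
    (θ := θ) (by push_cast at h1 ⊢; linarith) (by push_cast at h2 ⊢; linarith)
  refine ⟨?_, fun hd ↦ ?_, fun l hl hd ↦ ?_⟩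
  · have hlo0 : (0 : ℝ) ≤ lo := by exact_mod_cast hlo
    have : (0 : ℝ) ≤ (lo : ℝ) / c.base.S := div_nonneg hlo0 hSr.le
    unfold P3; linarith
  · have : ((c.base.mT : ℤ) : ℝ) / c.base.S ≤ (loT : ℝ) / c.base.S := by
      gcongr; exact_mod_cast hduty hd
    exact this.trans hT
  · obtain ⟨lol, hlol, hle⟩ := hlat l hl hd
    have hTl := cellLoT3_sound hS hpi hMc hden hnin hnum heta' htab (hFl l hl) (b.j0 + i) hlol
      (θ := θ) (by push_cast at h1 ⊢; linarith) (by push_cast at h2 ⊢; linarith)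
    have : ((l.mT : ℤ) : ℝ) / c.base.S ≤ (lol : ℝ) / c.base.S := by gcongr
    exact this.trans hTl

/-- `cellsOKL` gives the cell bounds. [folklore] -/
theorem cellBounds_of_cellsOKL : CellBounds c := fun _ hb _ hi _ h1 h2 ↦
  cell_bounds3 hS hpi hrho hρ hC hR hF hFl hblocks hcells hb hi h1 h2

end regimes

section covered

variable (hblocks : c.base.blocksOK = true) (hcb : CellBounds c)
include hblocks hcb

/-- On the covered range the full function is `≥ 0`. [folklore] -/
theorem P3_nonneg_of_covered {b0 bl : DKBlock} (h0 : c.base.blocks.head? = some b0)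
    (hl : c.base.blocks.getLast? = some bl) {θ : ℝ} (h1 : DKCert.bStart b0 ≤ θ) (h2 : θ ≤ DKCert.bEnd bl) :
    0 ≤ c.P3 θ := by
  obtain ⟨hbs, hchain, _⟩ := DKCert.blocksOK_sound hblocks
  obtain ⟨b, hb, hs, he⟩ := DKCert.exists_block c.base.blocks b0 bl h0 hl hchain (fun b hb ↦ (hbs b hb).1) θ h1 h2
  obtain ⟨i, hi, hc1, hc2⟩ := DKCert.exists_cell (hbs b hb).1 (hbs b hb).2.1 hs he
  exact (hcb hb hi hc1 hc2).1

/-- The base periodic part is `≥ mT/S` at every point of `[−π, π]` inside the covered range. [folklore] -/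
theorem baseT_ge_of_covered {b0 bl : DKBlock} (h0 : c.base.blocks.head? = some b0)
    (hl : c.base.blocks.getLast? = some bl) {θ : ℝ} (h1 : DKCert.bStart b0 ≤ θ) (h2 : θ ≤ DKCert.bEnd bl)
    (hπ1 : -π ≤ θ) (hπ2 : θ ≤ π) :
    (c.base.mT : ℝ) / c.base.S ≤ sumVal (DKCert.cList c.terms3 c.terms3R) θ := by
  obtain ⟨hbs, hchain, _⟩ := DKCert.blocksOK_sound hblocks
  obtain ⟨b, hb, hs, he⟩ := DKCert.exists_block c.base.blocks b0 bl h0 hl hchain (fun b hb ↦ (hbs b hb).1) θ h1 h2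
  have hMc := (hbs b hb).1
  have hMcr : (0 : ℝ) < b.Mc := by exact_mod_cast hMc
  obtain ⟨i, hi, hc1, hc2⟩ := DKCert.exists_cell hMc (hbs b hb).2.1 hs he
  refine (hcb hb hi hc1 hc2).2.1 ?_
  unfold DKCert.periodDuty
  simp only [Bool.and_eq_true, decide_eq_true_eq]
  constructor
  · have : 2 * π * ((b.j0 + i : ℤ) : ℝ) ≤ π * b.Mc := by
      rw [div_le_iff₀ hMcr] at hc1; nlinarith
    have : 2 * ((b.j0 + i : ℤ) : ℝ) ≤ b.Mc := by nlinarith [Real.pi_pos]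
    exact_mod_cast this
  · have : -π * b.Mc ≤ 2 * π * (((b.j0 + i : ℤ) : ℝ) + 1) := by
      rw [le_div_iff₀ hMcr] at hc2; nlinarith
    have : -(b.Mc : ℝ) ≤ 2 * ((b.j0 + i : ℤ) : ℝ) + 2 := by nlinarith [Real.pi_pos]
    exact_mod_cast this

/-- A lattice part is `≥ mT_p/S` at every point of `[−π/r_p, π/r_p]` inside the covered range. [folklore] -/
theorem latT_ge_of_covered (hS : 0 < c.base.S) {b0 bl : DKBlock} (h0 : c.base.blocks.head? = some b0)
    (hl : c.base.blocks.getLast? = some bl) {l : DKLat} (hll : l ∈ c.lats) (hr : MI.mem c.base.S (c.ratR l) l.rI)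
    (hlo : 0 < l.rI.lo) {θ : ℝ} (h1 : DKCert.bStart b0 ≤ θ) (h2 : θ ≤ DKCert.bEnd bl)
    (hz1 : -(π / c.ratR l) ≤ θ) (hz2 : θ ≤ π / c.ratR l) :
    (l.mT : ℝ) / c.base.S ≤ sumVal (c.latTermsR l) θ := by
  obtain ⟨hbs, hchain, _⟩ := DKCert.blocksOK_sound hblocks
  obtain ⟨b, hb, hs, he⟩ := DKCert.exists_block c.base.blocks b0 bl h0 hl hchain (fun b hb ↦ (hbs b hb).1) θ h1 h2
  have hMc := (hbs b hb).1
  have hMcr : (0 : ℝ) < b.Mc := by exact_mod_cast hMc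
  have hSr : (0 : ℝ) < c.base.S := by exact_mod_cast hS
  obtain ⟨i, hi, hc1, hc2⟩ := DKCert.exists_cell hMc (hbs b hb).2.1 hs he
  refine (hcb hb hi hc1 hc2).2.2 l hll ?_
  -- the cell meets `|θ| ≤ π/r_p ⊆ |θ| ≤ π S / rI.lo`
  have hlor : (0 : ℝ) < l.rI.lo := by exact_mod_cast hlo
  have hrlo : (l.rI.lo : ℝ) ≤ c.ratR l * c.base.S := hr.1
  have hrpos : 0 < c.ratR l := by
    rcases le_or_gt (c.ratR l) 0 with hneg | hpos
    · have : c.ratR l * c.base.S ≤ 0 := mul_nonpos_of_nonpos_of_nonneg hneg hSr.le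
      linarith
    · exact hpos
  have hzone : π / c.ratR l ≤ π * c.base.S / l.rI.lo := by
    rw [div_le_div_iff₀ hrpos hlor]
    nlinarith [Real.pi_pos]
  unfold latDuty
  simp only [Bool.and_eq_true, decide_eq_true_eq]
  constructor
  · -- 2πj/Mc ≤ θ ≤ π/r ≤ πS/lo  ⇒  2 j lo ≤ Mc S
    have hθ' : 2 * π * ((b.j0 + i : ℤ) : ℝ) / b.Mc ≤ π * c.base.S / l.rI.lo := hc1.trans (hz2.trans hzone)
    rw [div_le_div_iff₀ hMcr hlor] at hθ'
    have : 2 * ((b.j0 + i : ℤ) : ℝ) * l.rI.lo ≤ (b.Mc : ℝ) * c.base.S := by nlinarith [Real.pi_pos]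
    exact_mod_cast this
  · have hθ' : -(π * c.base.S / l.rI.lo) ≤ 2 * π * (((b.j0 + i : ℤ) : ℝ) + 1) / b.Mc := by
      have := neg_le_neg hzone; exact this.trans (hz1.trans hc2)
    rw [← neg_div, div_le_div_iff₀ hlor hMcr] at hθ'
    have : -((b.Mc : ℝ) * c.base.S) ≤ (2 * ((b.j0 + i : ℤ) : ℝ) + 2) * l.rI.lo := by nlinarith [Real.pi_pos]
    exact_mod_cast this

end covered

/-- The cell bounds from the frame flags, the lattice facts (`latsOK_sound` / `latsOKw_sound`) and `cellsOKL`. [folklore] -/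
theorem cellBounds_of_partsL (hconsts : c.base.constsOK = true) (hvals : c.base.valsOK = true)
    (hblocks : c.base.blocksOK = true) (hratm : ∀ l ∈ c.lats, MI.mem c.base.S (c.ratR l) l.rI)
    (hwin : ∀ l ∈ c.lats, (c.latWinTerms l).isSome = true) (hcells : c.cellsOKL = true) : CellBounds c := by
  obtain ⟨hS, hp0, hD, _, hR, _, hpi, hlog, hrho, hC⟩ := DKCert.constsOK_sound hconsts
  obtain ⟨hρ, _⟩ := DKCert.rhoR_pos_and_mul hp0 hD
  have hF := terms3_repr hS hpi hlog hp0 hvals hratm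
  have hFl : ∀ l ∈ c.lats, List.Forall₂ (DKCert.GRepr c.base.S c.base.R) (c.latTerms l) (c.latTermsR l) := by
    intro l hl
    obtain ⟨ws, hws⟩ := Option.isSome_iff_exists.1 (hwin l hl)
    exact latTerms_repr hS hpi hlog hp0 hvals (hratm l hl) hws
  exact cellBounds_of_cellsOKL hS hpi hrho hρ hC hR hF hFl hblocks hcells

/-! ### Reduction modulo a period; the atoms in `τ`; admissibility -/

/-- Reduction of a real number modulo a period `P > 0` into `[−P/2, P/2]`. [folklore] -/
theorem exists_reduce (P : ℝ) (hP : 0 < P) (θ : ℝ) : ∃ m : ℤ, -(P / 2) ≤ θ - m * P ∧ θ - m * P ≤ P / 2 := by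
  refine ⟨⌊(θ + P / 2) / P⌋, ?_, ?_⟩
  · have := Int.floor_le ((θ + P / 2) / P)
    rw [le_div_iff₀ hP] at this; linarith
  · have := Int.lt_floor_add_one ((θ + P / 2) / P)
    rw [div_lt_iff₀ hP] at this; linarith

/-- The lattice atoms evaluate to their `trigSum` in `τ`. [folklore] -/
theorem sumVal_latJoinR_eq_trigSum (hp0 : 2 ≤ c.base.p0) (hD : 1 ≤ c.base.D) (τ : ℝ) :
    ∀ (ls : List DKLat), (∀ l ∈ ls, 2 ≤ l.p ∧ 1 ≤ l.D) →
      sumVal (c.latJoinR ls) (c.base.omegaR * τ) = trigSum (c.latJoinT ls) τ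
  | [], _ => by simp [latJoinR, latJoinT]
  | l :: ls, h => by
      simp only [latJoinR, latJoinT, DKCert.sumVal_append]
      rw [sumVal_latJoinR_eq_trigSum hp0 hD τ ls (fun l' hl' ↦ h l' (by simp [hl']))]
      have hmul := (ratR_pos_and_mul hp0 hD (h l (by simp)).1 (h l (by simp)).2).2
      have hat : ∀ (as : List DKAtom), sumVal (as.map (c.latAtomR l)) (c.base.omegaR * τ) =
          trigSum (as.map (c.latAtomT l)) τ := by
        intro as
        induction as with
        | nil => simp
        | cons atm as ih =>
            rw [List.map_cons, List.map_cons, sumVal_cons, trigSum_cons, ih]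
            simp only [RTerm.val, latAtomR, TrigAtom.eval, latAtomT]
            rw [← hmul]; ring_nf
      unfold latAtomsR
      rw [hat l.atoms]
      have : trigSum (List.map (c.latAtomT l) l.atoms ++ c.latJoinT ls) τ =
          trigSum (List.map (c.latAtomT l) l.atoms) τ + trigSum (c.latJoinT ls) τ := by
        simp [trigSum, List.map_append, List.sum_append]
      rw [this]

/-- Every atom of `allAtomsT` has frequency `≥ log (N+1)`, from the frame. [folklore] -/
theorem allAtomsT_admissible_of_frame (hf : c.frame3OK = true) :
    ∀ A ∈ c.allAtomsT, Real.log ((c.base.N : ℝ) + 1) ≤ A.x := by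
  unfold frame3OK baseFrameOK at hf
  simp only [Bool.and_eq_true] at hf
  obtain ⟨⟨⟨⟨⟨⟨⟨hconsts, _⟩, _⟩, _⟩, hatoms⟩, hlats⟩, _⟩, _⟩ := hf
  obtain ⟨hS, hp0, hD, _, _, _, _, hlog, _, _⟩ := DKCert.constsOK_sound hconsts
  obtain ⟨_, _, hlat⟩ := latsOK_sound hlats hS hlog
  have hN1 : (0 : ℝ) < (c.base.N : ℝ) + 1 := by positivity
  intro A hA
  unfold allAtomsT at hA
  rw [List.mem_append] at hA
  rcases hA with hA | hA
  · rw [List.mem_map] at hA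
    obtain ⟨atm, hatm, rfl⟩ := hA
    unfold DKCert.atomsOK at hatoms
    rw [List.all_eq_true] at hatoms
    have h := hatoms atm hatm
    rw [decide_eq_true_eq] at h
    simp only [DKCert.atomT, DKCert.omegaR]
    have hp0r : (1 : ℝ) < c.base.p0 := by exact_mod_cast hp0
    have hDr : (0 : ℝ) < c.base.D := by exact_mod_cast hD
    have hreal : ((c.base.N : ℝ) + 1) ^ c.base.D ≤ (c.base.p0 : ℝ) ^ atm.k := by exact_mod_cast h
    have hlogle := Real.log_le_log (by positivity) hreal
    rw [Real.log_pow, Real.log_pow] at hlogle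
    rw [← mul_div_assoc, le_div_iff₀ hDr]
    linarith
  · -- lattice atoms
    have : ∀ (ls : List DKLat), (∀ l ∈ ls, l ∈ c.lats) → A ∈ c.latJoinT ls → Real.log ((c.base.N : ℝ) + 1) ≤ A.x := by
      intro ls
      induction ls with
      | nil => intro _ h; simp [latJoinT] at h
      | cons l ls ih =>
          intro hmem h
          simp only [latJoinT, List.mem_append, List.mem_map] at h
          rcases h with ⟨atm, hatm, rfl⟩ | h
          · obtain ⟨hp, _, hDl, _, _, hadm, _⟩ := hlat l (hmem l (by simp))
            have h := hadm atm hatm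
            simp only [latAtomT, omegaL]
            have hpr : (1 : ℝ) < l.p := by exact_mod_cast hp
            have hDr : (0 : ℝ) < l.D := by exact_mod_cast hDl
            have hreal : ((c.base.N : ℝ) + 1) ^ l.D ≤ (l.p : ℝ) ^ atm.k := by exact_mod_cast h
            have hlogle := Real.log_le_log (by positivity) hreal
            rw [Real.log_pow, Real.log_pow] at hlogle
            rw [← mul_div_assoc, le_div_iff₀ hDr]
            linarith
          · exact ih (fun l' hl' ↦ hmem l' (by simp [hl'])) h
    exact this c.lats (fun l hl ↦ hl) hA

/-- Every atom of `allAtomsT` has frequency `≥ log (N+1)`, from `checkL`. [folklore] -/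
theorem allAtomsT_admissible (hc : c.checkL = true) : ∀ A ∈ c.allAtomsT, Real.log ((c.base.N : ℝ) + 1) ≤ A.x := by
  unfold checkL at hc
  simp only [Bool.and_eq_true] at hc
  exact allAtomsT_admissible_of_frame hc.1

/-! ### Assembly lemmas for kernel-sized declarations -/

/-- `frame3OK` from its four parts. [folklore] -/
theorem frame3OK_of_parts (h1 : c.baseFrameOK = true) (h2 : c.latsOK = true) (h3 : c.latCoverOK = true)
    (h4 : c.tailOK3 = true) : c.frame3OK = true := by
  unfold frame3OK; rw [h1, h2, h3, h4]; rfl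

/-- `baseFrameOK` from its five parts. [folklore] -/
theorem baseFrameOK_of_parts (h1 : c.base.constsOK = true) (h2 : c.base.valsOK = true)
    (h3 : c.base.valsNodup = true) (h4 : c.base.blocksOK = true) (h5 : c.base.atomsOK = true) :
    c.baseFrameOK = true := by
  unfold baseFrameOK; rw [h1, h2, h3, h4, h5]; rfl

/-- `checkL` from frame and cells. [folklore] -/
theorem checkL_of_parts (hf : c.frame3OK = true) (hc : c.cellsOKL = true) : c.checkL = true := by
  unfold checkL; rw [hf, hc]; rfl

/-- Splitting a cell range of a block: ranges `[i0, i0+m)` and `[i0+m, i0+m+n)` give `[i0, i0+m+n)`.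
[folklore] -/
theorem blockRangeOKL_split (b : DKBlock) (i0 m n : ℕ) (h1 : c.blockRangeOKL b i0 m = true)
    (h2 : c.blockRangeOKL b (i0 + m) n = true) : c.blockRangeOKL b i0 (m + n) = true := by
  unfold blockRangeOKL at *
  simp only [List.all_eq_true, List.mem_range] at *
  intro i hi
  by_cases him : i < m
  · exact h1 i him
  · have h := h2 (i - m) (by omega)
    have e : i0 + m + (i - m) = i0 + i := by omega
    rw [e] at h
    exact h

/-- `cellsOKL` from one range per block. [folklore] -/
theorem cellsOKL_of_blocks (h : ∀ b ∈ c.base.blocks, c.blockRangeOKL b 0 b.n = true) : c.cellsOKL = true := by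
  unfold cellsOKL; rw [List.all_eq_true]; exact h

end DKCert3

end Summit.Ventures.WeilGRH

end
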